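import Literature.NumberTheory.LFunctions.MertensTail
import Literature.NumberTheory.LFunctions.MertensFormula
import Literature.NumberTheory.LFunctions.PrimeRpowTailChebyshev
import Mathlib.Analysis.SpecialFunctions.Pow.Complex
import Mathlib.Analysis.SpecialFunctions.Complex.LogDeriv
import Mathlib.Analysis.Calculus.MeanValue
import Mathlib.Analysis.PSeries
import HarnessLib

/-!
# Tao–Teräväinen 2022, §8 (`k = 2`, `ℓ = 0`): Mertens-type sums for the main-term Euler product

Topic `Literature/Barriers/Parity`, sub-namespace `TaoTeravainen.MainTerm`; second file of the
Goldston–Yıldırım-type computation (8.8)–(8.25) of Tao–Teräväinen (arXiv:2109.06291, §8), a file of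
the proof DAG of `Literature.Barriers.Parity.TaoTeravainen2021_prop72_81_pair`. Everything here is PROVED.

The analysis of `∏_p E_p` in §8 ("by Mertens' theorem (3.7) `∏_p E_p ≪ log^{O(1)} R`",
"From Mertens' theorem ((3.3) for `log_R p ≤ log^{1/(100k)} η` and (3.5) for `log_R p > log^{1/(100k)} η`)
we have `∑_p min(log_R p/log^{1/(6k)} η, exp(-2 log_R p))/p ≪ 1/log^{1/(7k)} η`", and (3.2)
`∏_p (1 - p^{-s}) = (1 + O(|s-1|))(s-1)`) consumes a handful of prime sums, which are assembled here
over an arbitrary finite set of primes `P` (in the application `P` = primes `< N`), with explicit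
constants, from the tree's Mertens estimates (`MertensBound.sum_log_div_prime_le`,
`Mertens.abs_primeRecipSum_sub_le`, `MertensBound.loglog_sub_loglog_le_sum_inv_prime_Icc`,
`sum_Ioc_prime_rpow_le`):

* `norm_one_sub_natCast_cpow_neg_le` — `‖1 - p^{-z}‖ ≤ ‖z‖ log p` for `Re z ≥ 0` (mean value),
  `norm_natCast_cpow_neg_le_one`;
* `alphaW σ X p = min(2, σ log p/X)`; `sum_log_div_filter_le`, `sum_inv_filter_Ioc_le`,
  `sum_rpow_filter_lt_le` (the three ranges), `rpowSum32` and `sum_log_sq_div_sq_le`,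
  `sum_log_div_sq_le`, `sum_inv_sq_le` (the convergent sums `∑ log²p/p², ∑ log p/p², ∑ 1/p²`),
  `sum_log_sq_div_filter_le`;
* `sum_alphaW_rpow_le_fine` — `∑_p min(2, σ log p/X) p^{-1-1/Y} ≤ σ(AY + 2)/X + 34 e^{-A}/A`
  (`A ≥ 1`), and `sum_alphaW_rpow_le_crude` — `≤ 2 max(0, log(σY/X)) + 72`;
* `norm_prod_one_sub_cpow_le` — `‖∏_{p ∈ P, p ≥ C₀} (1 - p^{-1-z})‖ ≤ K(C₀) σ²/X` for `Re z = 1/X`,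
  `‖z‖ ≤ σ/X`, when `P` contains the primes of `[C₀, e^X]` (the elementary substitute for the size
  `|1/ζ(1+z)| ≍ |z|` of the main term, used only as an upper bound).
  [cite: TaoTeravainen2021, §3.1 (3.2)–(3.7) and §8 (8.19)–(8.25)]
-/

noncomputable section

open Finset Real

namespace Literature.Barriers.Parity

namespace TaoTeravainen

namespace MainTerm

open Literature.NumberTheory.LFunctions (sum_Ioc_prime_rpow_le)
open Literature.NumberTheory.LFunctions.MertensBound (sum_log_div_prime_le
  loglog_sub_loglog_le_sum_inv_prime_Icc)
open Literature.NumberTheory.LFunctions.Mertens (primeRecipSum abs_primeRecipSum_sub_le)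

/-! ### Complex powers of primes -/

/-- `‖p^{-z}‖ = p^{-Re z}` (`p ≥ 1`; private copy of a one-liner available elsewhere in the tree under
heavy imports: `Complex.norm_natCast_cpow_of_pos` + `Complex.neg_re`). [folklore] -/
private theorem norm_natCast_cpow_neg' {p : ℕ} (hp : p ≠ 0) (z : ℂ) :
    ‖(p : ℂ) ^ (-z)‖ = (p : ℝ) ^ (-z.re) := by
  rw [Complex.norm_natCast_cpow_of_pos (Nat.pos_of_ne_zero hp), Complex.neg_re]

/-- `‖p^{-z}‖ ≤ 1` for `Re z ≥ 0`, `p ≥ 1`. [folklore] -/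
theorem norm_natCast_cpow_neg_le_one {p : ℕ} (hp : p ≠ 0) {z : ℂ} (hz : 0 ≤ z.re) :
    ‖(p : ℂ) ^ (-z)‖ ≤ 1 := by
  rw [norm_natCast_cpow_neg' hp]
  exact Real.rpow_le_one_of_one_le_of_nonpos (by exact_mod_cast Nat.pos_of_ne_zero hp) (by linarith)

/-- **`‖1 - p^{-z}‖ ≤ ‖z‖ log p`** for `Re z ≥ 0` and `p ≥ 1` (the mean value inequality for
`s ↦ exp(-s z log p)` on `[0, 1]`; this is the "Taylor expansion" step
"`1 - p^{-(1+it)/log R} = O((1+|t|) log_R p)`" of the source). [cite: TaoTeravainen2021, §8 (8.22)] -/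
theorem norm_one_sub_natCast_cpow_neg_le {p : ℕ} (hp : p ≠ 0) {z : ℂ} (hz : 0 ≤ z.re) :
    ‖1 - (p : ℂ) ^ (-z)‖ ≤ ‖z‖ * Real.log p := by
  have hp0 : (p : ℂ) ≠ 0 := Nat.cast_ne_zero.mpr hp
  have hlog : 0 ≤ Real.log p := Real.log_natCast_nonneg p
  set w : ℂ := -(z * (Real.log p : ℂ)) with hw
  -- `s ↦ exp(s w)` on `[0, 1]`
  set f : ℝ → ℂ := fun s => Complex.exp ((s : ℂ) * w) with hf
  have hderiv : ∀ s : ℝ, HasDerivAt f (Complex.exp ((s : ℂ) * w) * w) s := by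
    intro s
    have h1 : HasDerivAt (fun s : ℝ => (s : ℂ) * w) ((1 : ℝ) * w) s := by
      have := (hasDerivAt_id s).ofReal_comp.mul_const w
      simpa using this
    have h2 := h1.cexp
    simp only [Complex.ofReal_one, one_mul] at h2
    exact h2
  have hbound : ∀ s ∈ Set.Ico (0 : ℝ) 1, ‖Complex.exp ((s : ℂ) * w) * w‖ ≤ ‖z‖ * Real.log p := by
    intro s hs
    rw [norm_mul, Complex.norm_exp]
    have hre : ((s : ℂ) * w).re = -(s * (z.re * Real.log p)) := by
      rw [hw, mul_neg, Complex.neg_re, Complex.re_ofReal_mul, Complex.re_mul_ofReal]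
    have hre0 : ((s : ℂ) * w).re ≤ 0 := by
      rw [hre, neg_nonpos]
      exact mul_nonneg hs.1 (mul_nonneg hz hlog)
    have hw' : ‖w‖ = ‖z‖ * Real.log p := by
      rw [hw, norm_neg, norm_mul, Complex.norm_real, Real.norm_eq_abs, abs_of_nonneg hlog]
    calc Real.exp ((s : ℂ) * w).re * ‖w‖ ≤ 1 * ‖w‖ :=
          mul_le_mul_of_nonneg_right (Real.exp_le_one_iff.mpr hre0) (norm_nonneg _)
      _ = ‖z‖ * Real.log p := by rw [one_mul, hw']
  have hmv := norm_image_sub_le_of_norm_deriv_le_segment_01'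
    (fun s _ => (hderiv s).hasDerivWithinAt) hbound
  have hf1 : f 1 = (p : ℂ) ^ (-z) := by
    rw [hf]
    dsimp only
    rw [Complex.cpow_def_of_ne_zero hp0, ← Complex.natCast_log, hw]
    congr 1
    push_cast
    ring
  have hf0 : f 0 = 1 := by simp [hf]
  rw [hf1, hf0] at hmv
  rwa [norm_sub_rev]

/-- `‖1 - p^{-z}‖ ≤ 2` for `Re z ≥ 0`. [folklore] -/
theorem norm_one_sub_natCast_cpow_neg_le_two {p : ℕ} (hp : p ≠ 0) {z : ℂ} (hz : 0 ≤ z.re) :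
    ‖1 - (p : ℂ) ^ (-z)‖ ≤ 2 := by
  calc ‖1 - (p : ℂ) ^ (-z)‖ ≤ ‖(1 : ℂ)‖ + ‖(p : ℂ) ^ (-z)‖ := norm_sub_le _ _
    _ ≤ 1 + 1 := by rw [norm_one]; exact add_le_add le_rfl (norm_natCast_cpow_neg_le_one hp hz)
    _ = 2 := by norm_num

/-- The weight `α_p = min(2, σ log p/X)` (a common bound for `‖1 - p^{-z}‖`, `Re z ≥ 0`,
`‖z‖ ≤ σ/X`). [cite: TaoTeravainen2021, §8 ("min((1+|t|) log_R p, 1)")] -/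
def alphaW (σ X : ℝ) (p : ℕ) : ℝ :=
  min 2 (σ * Real.log p / X)

/-- `0 ≤ α_p` for `σ ≥ 0`, `X > 0`. [folklore] -/
theorem alphaW_nonneg {σ X : ℝ} (hσ : 0 ≤ σ) (hX : 0 < X) (p : ℕ) : 0 ≤ alphaW σ X p :=
  le_min (by norm_num) (div_nonneg (mul_nonneg hσ (Real.log_natCast_nonneg p)) hX.le)

/-- `α_p ≤ 2`. [folklore] -/
theorem alphaW_le_two (σ X : ℝ) (p : ℕ) : alphaW σ X p ≤ 2 := min_le_left _ _

/-- `α_p ≤ σ log p/X`. [folklore] -/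
theorem alphaW_le (σ X : ℝ) (p : ℕ) : alphaW σ X p ≤ σ * Real.log p / X := min_le_right _ _

/-- **`‖1 - p^{-z}‖ ≤ α_p`** when `Re z ≥ 0`, `‖z‖ ≤ σ/X` (`X > 0`). [cite: TaoTeravainen2021, §8 (8.22)] -/
theorem norm_one_sub_natCast_cpow_neg_le_alphaW {p : ℕ} (hp : p ≠ 0) {z : ℂ} (hz : 0 ≤ z.re)
    {σ X : ℝ} (hzσ : ‖z‖ ≤ σ / X) :
    ‖1 - (p : ℂ) ^ (-z)‖ ≤ alphaW σ X p := by
  refine le_min (norm_one_sub_natCast_cpow_neg_le_two hp hz) ?_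
  calc ‖1 - (p : ℂ) ^ (-z)‖ ≤ ‖z‖ * Real.log p := norm_one_sub_natCast_cpow_neg_le hp hz
    _ ≤ σ / X * Real.log p := mul_le_mul_of_nonneg_right hzσ (Real.log_natCast_nonneg p)
    _ = σ * Real.log p / X := by ring

/-- `x^{-(1+δ)} ≤ 1/x` for `x ≥ 1`, `δ ≥ 0`. [folklore] -/
theorem rpow_neg_one_add_le {x δ : ℝ} (hx : 1 ≤ x) (hδ : 0 ≤ δ) : x ^ (-(1 + δ)) ≤ 1 / x := by
  rw [one_div, ← Real.rpow_neg_one]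
  exact Real.rpow_le_rpow_of_exponent_le hx (by linarith)

/-! ### Sums over a finite set of primes: the three ranges -/

section Sums

variable {P : Finset ℕ} (hP : ∀ p ∈ P, p.Prime)
include hP

/-- **The first range** (Mertens' first theorem): `∑_{p ∈ P, p ≤ w} log p/p ≤ log w + log 4`
(`w ≥ 1`). [cite: TaoTeravainen2021, §3.1 (3.3)] -/
theorem sum_log_div_filter_le {w : ℝ} (hw : 1 ≤ w) :
    ∑ p ∈ P.filter (fun p : ℕ => (p : ℝ) ≤ w), Real.log p / p ≤ Real.log w + Real.log 4 := by
  have hsub : P.filter (fun p : ℕ => (p : ℝ) ≤ w) ⊆ Nat.primesLE ⌊w⌋₊ := by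
    intro p hp
    rw [mem_filter] at hp
    exact Nat.mem_primesLE.mpr ⟨Nat.le_floor hp.2, hP p hp.1⟩
  have hfl : (1 : ℝ) ≤ ⌊w⌋₊ := by exact_mod_cast Nat.le_floor (by simpa using hw)
  calc ∑ p ∈ P.filter (fun p : ℕ => (p : ℝ) ≤ w), Real.log p / p
      ≤ ∑ p ∈ Nat.primesLE ⌊w⌋₊, Real.log p / p :=
        sum_le_sum_of_subset_of_nonneg hsub fun p _ _ =>
          div_nonneg (Real.log_natCast_nonneg p) (Nat.cast_nonneg p)
    _ ≤ Real.log ⌊w⌋₊ + Real.log 4 := sum_log_div_prime_le ⌊w⌋₊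
    _ ≤ Real.log w + Real.log 4 := by
        gcongr
        exact Nat.floor_le (by linarith)

/-- `∑_{p ∈ P, p ≤ w} log²p/p ≤ log w (log w + log 4)` (`w ≥ 1`). [cite: TaoTeravainen2021, §3.1 (3.3)] -/
theorem sum_log_sq_div_filter_le {w : ℝ} (hw : 1 ≤ w) :
    ∑ p ∈ P.filter (fun p : ℕ => (p : ℝ) ≤ w), Real.log p ^ 2 / p ≤
      Real.log w * (Real.log w + Real.log 4) := by
  have hlogw : 0 ≤ Real.log w := Real.log_nonneg hw
  calc ∑ p ∈ P.filter (fun p : ℕ => (p : ℝ) ≤ w), Real.log p ^ 2 / p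
      ≤ ∑ p ∈ P.filter (fun p : ℕ => (p : ℝ) ≤ w), Real.log w * (Real.log p / p) := by
        refine sum_le_sum fun p hp => ?_
        rw [mem_filter] at hp
        have hp0 : (0 : ℝ) < p := by exact_mod_cast (hP p hp.1).pos
        rw [sq, mul_div_assoc]
        exact mul_le_mul_of_nonneg_right (Real.log_le_log hp0 hp.2)
          (div_nonneg (Real.log_natCast_nonneg p) hp0.le)
    _ = Real.log w * ∑ p ∈ P.filter (fun p : ℕ => (p : ℝ) ≤ w), Real.log p / p := by rw [mul_sum]
    _ ≤ Real.log w * (Real.log w + Real.log 4) :=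
        mul_le_mul_of_nonneg_left (sum_log_div_filter_le hP hw) hlogw

/-- **The middle range** (Mertens' second theorem, two-sided, tree: `abs_primeRecipSum_sub_le`):
`∑_{p ∈ P, w < p ≤ w'} 1/p ≤ log log w' - log log w + 24` for `2 ≤ w ≤ w'`.
[cite: TaoTeravainen2021, §3.1 (3.3)] -/
theorem sum_inv_filter_Ioc_le {w w' : ℝ} (hw : 2 ≤ w) (hww' : w ≤ w') :
    ∑ p ∈ P.filter (fun p : ℕ => w < p ∧ (p : ℝ) ≤ w'), (1 : ℝ) / p ≤
      Real.log (Real.log w') - Real.log (Real.log w) + 24 := by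
  have hw' : 2 ≤ w' := hw.trans hww'
  -- compare with `S(w') - S(w)`
  have hfl : ⌊w⌋₊ ≤ ⌊w'⌋₊ := Nat.floor_le_floor hww'
  have hsub1 : Nat.primesLE ⌊w⌋₊ ⊆ Nat.primesLE ⌊w'⌋₊ := fun p hp => by
    rw [Nat.mem_primesLE] at hp ⊢; exact ⟨hp.1.trans hfl, hp.2⟩
  have hsub2 : P.filter (fun p : ℕ => w < p ∧ (p : ℝ) ≤ w') ⊆ Nat.primesLE ⌊w'⌋₊ \ Nat.primesLE ⌊w⌋₊ := by
    intro p hp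
    rw [mem_filter] at hp
    rw [mem_sdiff, Nat.mem_primesLE, Nat.mem_primesLE]
    refine ⟨⟨Nat.le_floor hp.2.2, hP p hp.1⟩, fun h => ?_⟩
    have : (p : ℝ) ≤ w := le_trans (by exact_mod_cast h.1) (Nat.floor_le (by linarith))
    linarith [hp.2.1]
  have hdiff : ∑ p ∈ Nat.primesLE ⌊w'⌋₊ \ Nat.primesLE ⌊w⌋₊, (1 : ℝ) / p =
      primeRecipSum w' - primeRecipSum w := by
    unfold primeRecipSum
    rw [← sum_sdiff hsub1, add_sub_cancel_right]
    simp only [one_div]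
  have h1 := abs_primeRecipSum_sub_le hw
  have h2 := abs_primeRecipSum_sub_le hw'
  rw [abs_le] at h1 h2
  have hl2 : Real.log 2 ≤ Real.log w := Real.log_le_log (by norm_num) hw
  have hl2' : Real.log 2 ≤ Real.log w' := Real.log_le_log (by norm_num) hw'
  have hlog2 : (0.69 : ℝ) < Real.log 2 := by linarith [Real.log_two_gt_d9]
  have h8 : 8 / Real.log w ≤ 12 := by
    rw [div_le_iff₀ (by linarith)]; nlinarith
  have h8' : 8 / Real.log w' ≤ 12 := by
    rw [div_le_iff₀ (by linarith)]; nlinarith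
  calc ∑ p ∈ P.filter (fun p : ℕ => w < p ∧ (p : ℝ) ≤ w'), (1 : ℝ) / p
      ≤ ∑ p ∈ Nat.primesLE ⌊w'⌋₊ \ Nat.primesLE ⌊w⌋₊, (1 : ℝ) / p :=
        sum_le_sum_of_subset_of_nonneg hsub2 fun p _ _ => by positivity
    _ = primeRecipSum w' - primeRecipSum w := hdiff
    _ ≤ Real.log (Real.log w') - Real.log (Real.log w) + 24 := by linarith [h1.1, h2.2]

/-- **The last range** ((3.5): "`∑_{p > y} p^{-1-1/log z} ≪ exp(-log_z y)/log_z y`", tree: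
`sum_Ioc_prime_rpow_le` from Chebyshev's bound): for `0 < δ ≤ 1` and an integer `v ≥ 2`,
`∑_{p ∈ P, p > v} p^{-(1+δ)} ≤ 3 log 4 · v^{-δ}/(δ log v)`. [cite: TaoTeravainen2021, §3.1 (3.5)] -/
theorem sum_rpow_filter_lt_le {δ : ℝ} (hδ : 0 < δ) (hδ1 : δ ≤ 1) {v : ℕ} (hv : 2 ≤ v) :
    ∑ p ∈ P.filter (fun p : ℕ => v < p), (p : ℝ) ^ (-(1 + δ)) ≤
      3 * Real.log 4 * (v : ℝ) ^ (-δ) / (δ * Real.log v) := by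
  set M : ℕ := max v (P.sup id) with hM
  have hvM : v ≤ M := le_max_left _ _
  have hsub : P.filter (fun p : ℕ => v < p) ⊆ (Ioc v M).filter Nat.Prime := by
    intro p hp
    rw [mem_filter] at hp ⊢
    refine ⟨mem_Ioc.mpr ⟨hp.2, ?_⟩, hP p hp.1⟩
    exact le_trans (le_sup (f := id) hp.1) (le_max_right _ _)
  have h := sum_Ioc_prime_rpow_le (σ := 1 + δ) (by linarith) (by linarith) hv hvM
  rw [show 1 - (1 + δ) = -δ by ring, show 1 + δ - 1 = δ by ring] at h
  exact le_trans (sum_le_sum_of_subset_of_nonneg hsub fun p _ _ => by positivity) h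

/-! ### The convergent sums `∑ log²p/p²`, `∑ log p/p²`, `∑ 1/p²` -/

omit hP in
/-- The constant `∑_n n^{-3/2}` (finite). [folklore] -/
def rpowSum32 : ℝ := ∑' n : ℕ, ((n : ℝ) ^ ((3 : ℝ) / 2))⁻¹

omit hP in
/-- Summability of `n^{-3/2}`. [folklore] -/
theorem summable_rpow32 : Summable fun n : ℕ => ((n : ℝ) ^ ((3 : ℝ) / 2))⁻¹ :=
  Real.summable_nat_rpow_inv.mpr (by norm_num)

omit hP in
/-- `0 ≤ ∑ n^{-3/2}`. [folklore] -/
theorem rpowSum32_nonneg : 0 ≤ rpowSum32 :=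
  tsum_nonneg fun n => by positivity

omit hP in
/-- `log n ≤ 4 n^{1/4}` (`n ≥ 0` real; private copy of `Real.log_le_rpow_div` at `ε = 1/4`). [folklore] -/
private theorem log_le_four_mul_rpow_quarter {x : ℝ} (hx : 0 ≤ x) : Real.log x ≤ 4 * x ^ ((1 : ℝ) / 4) := by
  have h := Real.log_le_rpow_div hx (by norm_num : (0 : ℝ) < 1 / 4)
  linarith [show x ^ ((1 : ℝ) / 4) / (1 / 4) = 4 * x ^ ((1 : ℝ) / 4) by ring]

omit hP in
/-- `log²n/n² ≤ 16 n^{-3/2}` for `n ≥ 1`. [folklore] -/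
theorem log_sq_div_sq_le {n : ℕ} (hn : 1 ≤ n) :
    Real.log n ^ 2 / (n : ℝ) ^ 2 ≤ 16 * ((n : ℝ) ^ ((3 : ℝ) / 2))⁻¹ := by
  have hn0 : (0 : ℝ) < n := by exact_mod_cast hn
  have hlog0 : 0 ≤ Real.log n := Real.log_natCast_nonneg n
  have h4 := log_le_four_mul_rpow_quarter hn0.le
  have hsq : Real.log n ^ 2 ≤ 16 * (n : ℝ) ^ ((1 : ℝ) / 2) := by
    calc Real.log n ^ 2 ≤ (4 * (n : ℝ) ^ ((1 : ℝ) / 4)) ^ 2 := pow_le_pow_left₀ hlog0 h4 2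
      _ = 16 * ((n : ℝ) ^ ((1 : ℝ) / 4)) ^ 2 := by ring
      _ = 16 * (n : ℝ) ^ ((1 : ℝ) / 2) := by
          rw [← Real.rpow_natCast, ← Real.rpow_mul hn0.le]; norm_num
  rw [div_le_iff₀ (by positivity)]
  calc Real.log n ^ 2 ≤ 16 * (n : ℝ) ^ ((1 : ℝ) / 2) := hsq
    _ = 16 * ((n : ℝ) ^ ((3 : ℝ) / 2))⁻¹ * (n : ℝ) ^ 2 := by
        rw [mul_assoc, ← Real.rpow_neg hn0.le, ← Real.rpow_natCast,
          ← Real.rpow_add hn0]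
        norm_num

omit hP in
/-- `log n/n² ≤ 4 n^{-3/2}` for `n ≥ 1`. [folklore] -/
theorem log_div_sq_le {n : ℕ} (hn : 1 ≤ n) :
    Real.log n / (n : ℝ) ^ 2 ≤ 4 * ((n : ℝ) ^ ((3 : ℝ) / 2))⁻¹ := by
  have hn0 : (0 : ℝ) < n := by exact_mod_cast hn
  have hn1 : (1 : ℝ) ≤ n := by exact_mod_cast hn
  have h4 := log_le_four_mul_rpow_quarter hn0.le
  have hq : (n : ℝ) ^ ((1 : ℝ) / 4) ≤ (n : ℝ) ^ ((1 : ℝ) / 2) :=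
    Real.rpow_le_rpow_of_exponent_le hn1 (by norm_num)
  rw [div_le_iff₀ (by positivity)]
  calc Real.log n ≤ 4 * (n : ℝ) ^ ((1 : ℝ) / 2) := h4.trans (by linarith)
    _ = 4 * ((n : ℝ) ^ ((3 : ℝ) / 2))⁻¹ * (n : ℝ) ^ 2 := by
        rw [mul_assoc, ← Real.rpow_neg hn0.le, ← Real.rpow_natCast,
          ← Real.rpow_add hn0]
        norm_num

omit hP in
/-- `1/n² ≤ n^{-3/2}` for `n ≥ 1`. [folklore] -/
theorem inv_sq_le_rpow {n : ℕ} (hn : 1 ≤ n) :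
    1 / (n : ℝ) ^ 2 ≤ ((n : ℝ) ^ ((3 : ℝ) / 2))⁻¹ := by
  have hn1 : (1 : ℝ) ≤ n := by exact_mod_cast hn
  rw [one_div]
  refine inv_anti₀ (by positivity) ?_
  calc (n : ℝ) ^ ((3 : ℝ) / 2) ≤ (n : ℝ) ^ ((2 : ℕ) : ℝ) :=
        Real.rpow_le_rpow_of_exponent_le hn1 (by norm_num)
    _ = (n : ℝ) ^ 2 := Real.rpow_natCast _ 2

/-- `∑_{p ∈ P} log²p/p² ≤ 16 ∑ n^{-3/2}`. [cite: TaoTeravainen2021, §8 ("∑_p min(…)²/p² ≪ … ∑_p 1/p^{3/2}")] -/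
theorem sum_log_sq_div_sq_le : ∑ p ∈ P, Real.log p ^ 2 / (p : ℝ) ^ 2 ≤ 16 * rpowSum32 := by
  calc ∑ p ∈ P, Real.log p ^ 2 / (p : ℝ) ^ 2 ≤ ∑ p ∈ P, 16 * ((p : ℝ) ^ ((3 : ℝ) / 2))⁻¹ :=
        sum_le_sum fun p hp => log_sq_div_sq_le (hP p hp).one_le
    _ = 16 * ∑ p ∈ P, ((p : ℝ) ^ ((3 : ℝ) / 2))⁻¹ := by rw [mul_sum]
    _ ≤ 16 * rpowSum32 := by
        gcongr
        exact summable_rpow32.sum_le_tsum P fun n _ => by positivity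

/-- `∑_{p ∈ P} log p/p² ≤ 4 ∑ n^{-3/2}`. [folklore] -/
theorem sum_log_div_sq_le : ∑ p ∈ P, Real.log p / (p : ℝ) ^ 2 ≤ 4 * rpowSum32 := by
  calc ∑ p ∈ P, Real.log p / (p : ℝ) ^ 2 ≤ ∑ p ∈ P, 4 * ((p : ℝ) ^ ((3 : ℝ) / 2))⁻¹ :=
        sum_le_sum fun p hp => log_div_sq_le (hP p hp).one_le
    _ = 4 * ∑ p ∈ P, ((p : ℝ) ^ ((3 : ℝ) / 2))⁻¹ := by rw [mul_sum]
    _ ≤ 4 * rpowSum32 := by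
        gcongr
        exact summable_rpow32.sum_le_tsum P fun n _ => by positivity

/-- `∑_{p ∈ P} 1/p² ≤ ∑ n^{-3/2}`. [folklore] -/
theorem sum_inv_sq_le : ∑ p ∈ P, 1 / (p : ℝ) ^ 2 ≤ rpowSum32 := by
  calc ∑ p ∈ P, 1 / (p : ℝ) ^ 2 ≤ ∑ p ∈ P, ((p : ℝ) ^ ((3 : ℝ) / 2))⁻¹ :=
        sum_le_sum fun p hp => inv_sq_le_rpow (hP p hp).one_le
    _ ≤ rpowSum32 := summable_rpow32.sum_le_tsum P fun n _ => by positivity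

/-! ### `∑_p min(2, σ log p/X) p^{-1-1/Y}`: the fine and the crude regime -/

/-- Splitting the sum at a real `w`: `∑_{p ∈ P} α_p p^{-1-1/Y} ≤ σ (∑_{p ≤ w} log p/p)/X + 2 ∑_{p > w} p^{-1-1/Y}`
(`σ ≥ 0`, `X, Y > 0`). [folklore] -/
theorem sum_alphaW_rpow_le_split {σ X Y : ℝ} (hσ : 0 ≤ σ) (hX : 0 < X) (hY : 0 < Y) (w : ℝ) :
    ∑ p ∈ P, alphaW σ X p * (p : ℝ) ^ (-(1 + 1 / Y)) ≤
      σ / X * ∑ p ∈ P.filter (fun p : ℕ => (p : ℝ) ≤ w), Real.log p / p +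
        2 * ∑ p ∈ P.filter (fun p : ℕ => w < (p : ℝ)), (p : ℝ) ^ (-(1 + 1 / Y)) := by
  have hsplit := (sum_filter_add_sum_filter_not P (fun p : ℕ => (p : ℝ) ≤ w)
    (fun p => alphaW σ X p * (p : ℝ) ^ (-(1 + 1 / Y)))).symm
  rw [hsplit]
  have hnot : P.filter (fun p : ℕ => ¬ (p : ℝ) ≤ w) = P.filter (fun p : ℕ => w < (p : ℝ)) := by
    refine filter_congr fun p _ => ?_; exact not_le
  rw [hnot, mul_sum, mul_sum]
  refine add_le_add (sum_le_sum fun p hp => ?_) (sum_le_sum fun p hp => ?_)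
  · -- `p ≤ w`: `α_p ≤ σ log p/X` and `p^{-1-1/Y} ≤ 1/p`
    rw [mem_filter] at hp
    have hp0 : (0 : ℝ) < p := by exact_mod_cast (hP p hp.1).pos
    have hp1 : (1 : ℝ) ≤ p := by exact_mod_cast (hP p hp.1).one_le
    have h1 : (p : ℝ) ^ (-(1 + 1 / Y)) ≤ (p : ℝ)⁻¹ := by
      rw [← one_div]; exact rpow_neg_one_add_le hp1 (by positivity)
    calc alphaW σ X p * (p : ℝ) ^ (-(1 + 1 / Y)) ≤ (σ * Real.log p / X) * (p : ℝ)⁻¹ :=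
          mul_le_mul (alphaW_le σ X p) h1 (by positivity)
            (div_nonneg (mul_nonneg hσ (Real.log_natCast_nonneg p)) hX.le)
      _ = σ / X * (Real.log p / p) := by ring
  · rw [mem_filter] at hp
    calc alphaW σ X p * (p : ℝ) ^ (-(1 + 1 / Y)) ≤ 2 * (p : ℝ) ^ (-(1 + 1 / Y)) :=
          mul_le_mul_of_nonneg_right (alphaW_le_two σ X p) (by positivity)
      _ = _ := rfl

/-- **The fine regime** ("(3.3) for small `log_R p` and (3.5) for large"): for `A ≥ 1`, `Y ≥ 2`,
`X > 0`, `σ ≥ 0`,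
`∑_{p ∈ P} min(2, σ log p/X) p^{-1-1/Y} ≤ σ (A Y + 2)/X + 34 e^{-A}/A` (cut at `w = e^{AY}`).
[cite: TaoTeravainen2021, §8 ("we have ∑_p min(log_R p/log^{1/(6k)} η, exp(-2 log_R p))/p ≪ 1/log^{1/(7k)} η")] -/
theorem sum_alphaW_rpow_le_fine {σ X Y A : ℝ} (hσ : 0 ≤ σ) (hX : 0 < X) (hY : 2 ≤ Y) (hA : 1 ≤ A) :
    ∑ p ∈ P, alphaW σ X p * (p : ℝ) ^ (-(1 + 1 / Y)) ≤
      σ * (A * Y + 2) / X + 34 * Real.exp (-A) / A := by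
  have hY0 : 0 < Y := by linarith
  set w : ℝ := Real.exp (A * Y) with hw
  have hAY : 2 ≤ A * Y := by nlinarith
  have hw2 : (4 : ℝ) ≤ w := by
    rw [hw]
    calc (4 : ℝ) ≤ Real.exp 2 := by
          have := Real.add_one_le_exp (1 : ℝ)
          have h2 : Real.exp 2 = Real.exp 1 * Real.exp 1 := by rw [← Real.exp_add]; norm_num
          nlinarith [Real.exp_pos (1 : ℝ)]
      _ ≤ Real.exp (A * Y) := Real.exp_le_exp.mpr hAY
  have hsplit := sum_alphaW_rpow_le_split hP hσ hX hY0 w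
  -- first range
  have h1 : σ / X * ∑ p ∈ P.filter (fun p : ℕ => (p : ℝ) ≤ w), Real.log p / p ≤ σ * (A * Y + 2) / X := by
    have hs := sum_log_div_filter_le hP (w := w) (by linarith)
    rw [hw, Real.log_exp] at hs
    have hlog4 : Real.log 4 ≤ 2 := by
      rw [show (4 : ℝ) = 2 ^ 2 by norm_num, Real.log_pow]; push_cast
      linarith [Real.log_two_lt_d9]
    calc σ / X * ∑ p ∈ P.filter (fun p : ℕ => (p : ℝ) ≤ w), Real.log p / p
        ≤ σ / X * (A * Y + 2) := mul_le_mul_of_nonneg_left (by linarith) (by positivity)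
      _ = σ * (A * Y + 2) / X := by ring
  -- last range: `p > w ≥ v := ⌊w⌋`
  set v : ℕ := ⌊w⌋₊ with hv
  have hv2 : 2 ≤ v := Nat.le_floor (by push_cast; linarith)
  have hvw : (v : ℝ) ≤ w := Nat.floor_le (by linarith)
  have hwv : w / 2 ≤ v := by
    have := Nat.lt_floor_add_one w
    rw [← hv] at this; linarith
  have hv0 : (0 : ℝ) < v := by linarith
  have h2 : ∑ p ∈ P.filter (fun p : ℕ => w < (p : ℝ)), (p : ℝ) ^ (-(1 + 1 / Y)) ≤
      17 * Real.exp (-A) / A := by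
    have hsub : P.filter (fun p : ℕ => w < (p : ℝ)) ⊆ P.filter (fun p : ℕ => v < p) := by
      intro p hp
      rw [mem_filter] at hp ⊢
      exact ⟨hp.1, by exact_mod_cast lt_of_le_of_lt hvw hp.2⟩
    have htail := sum_rpow_filter_lt_le hP (δ := 1 / Y) (by positivity)
      (by rw [div_le_one hY0]; linarith) hv2
    -- `v^{-1/Y} ≤ (w/2)^{-1/Y} ≤ 2 e^{-A}` and `log v ≥ AY/2`
    have hvpow : (v : ℝ) ^ (-(1 / Y)) ≤ 2 * Real.exp (-A) := by
      have h1 : (v : ℝ) ^ (-(1 / Y)) ≤ (w / 2) ^ (-(1 / Y)) :=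
        Real.rpow_le_rpow_of_nonpos (by positivity) hwv (by
          have : 0 < 1 / Y := by positivity
          linarith)
      have h2 : (w / 2) ^ (-(1 / Y)) = Real.exp (-A) * (2 : ℝ) ^ (1 / Y) := by
        rw [Real.div_rpow (by positivity) (by norm_num), hw, ← Real.exp_mul,
          show A * Y * -(1 / Y) = -A by field_simp, Real.rpow_neg (by norm_num), div_eq_mul_inv,
          inv_inv]
      have h3 : (2 : ℝ) ^ (1 / Y) ≤ 2 := by
        calc (2 : ℝ) ^ (1 / Y) ≤ (2 : ℝ) ^ (1 : ℝ) :=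
              Real.rpow_le_rpow_of_exponent_le (by norm_num) (by rw [div_le_one hY0]; linarith)
          _ = 2 := Real.rpow_one 2
      calc (v : ℝ) ^ (-(1 / Y)) ≤ Real.exp (-A) * (2 : ℝ) ^ (1 / Y) := h1.trans h2.le
        _ ≤ Real.exp (-A) * 2 := mul_le_mul_of_nonneg_left h3 (Real.exp_pos _).le
        _ = 2 * Real.exp (-A) := mul_comm _ _
    have hlogv : A * Y / 2 ≤ Real.log v := by
      have hl : Real.log (w / 2) ≤ Real.log v := Real.log_le_log (by positivity) hwv
      rw [Real.log_div (by positivity) (by norm_num), hw, Real.log_exp] at hl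
      have : Real.log 2 ≤ A * Y / 2 := by linarith [Real.log_two_lt_d9]
      linarith
    have hden : (1 / Y) * (A * Y / 2) ≤ (1 / Y) * Real.log v :=
      mul_le_mul_of_nonneg_left hlogv (by positivity)
    have hden' : (1 / Y) * (A * Y / 2) = A / 2 := by field_simp
    have hA0 : 0 < A := by linarith
    have hlog4 : Real.log 4 ≤ 1.4 := by
      rw [show (4 : ℝ) = 2 ^ 2 by norm_num, Real.log_pow]; push_cast
      linarith [Real.log_two_lt_d9]
    have hlog4' : 0 < Real.log 4 := Real.log_pos (by norm_num)
    calc ∑ p ∈ P.filter (fun p : ℕ => w < (p : ℝ)), (p : ℝ) ^ (-(1 + 1 / Y))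
        ≤ ∑ p ∈ P.filter (fun p : ℕ => v < p), (p : ℝ) ^ (-(1 + 1 / Y)) :=
          sum_le_sum_of_subset_of_nonneg hsub fun p _ _ => by positivity
      _ ≤ 3 * Real.log 4 * (v : ℝ) ^ (-(1 / Y)) / ((1 / Y) * Real.log v) := htail
      _ ≤ 3 * Real.log 4 * (2 * Real.exp (-A)) / (A / 2) := by
          rw [← hden']
          exact div_le_div₀ (by positivity) (by gcongr) (by positivity) hden
      _ = 12 * Real.log 4 * Real.exp (-A) / A := by ring
      _ ≤ 17 * Real.exp (-A) / A := by
          refine div_le_div_of_nonneg_right ?_ hA0.le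
          nlinarith [Real.exp_pos (-A)]
  calc _ ≤ _ := hsplit
    _ ≤ σ * (A * Y + 2) / X + 2 * (17 * Real.exp (-A) / A) := add_le_add h1 (by linarith)
    _ = σ * (A * Y + 2) / X + 34 * Real.exp (-A) / A := by ring

/-- **The crude regime**: for `σ ≥ 1` and `X, Y ≥ 2` (in either order),
`∑_{p ∈ P} min(2, σ log p/X) p^{-1-1/Y} ≤ 2 max(0, log(σY/X)) + 72`. (Cut at `w = e^{X/σ}` when
`log 2 ≤ X/σ ≤ Y`, at `w = e^{X/σ} > e^Y` when `X/σ > Y`, and at `w = 2` when `X/σ < log 2`; the middle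
range is estimated by the two-sided Mertens theorem.) [cite: TaoTeravainen2021, §8 (8.19)–(8.20)] -/
theorem sum_alphaW_rpow_le_crude {σ X Y : ℝ} (hσ : 1 ≤ σ) (hY : 2 ≤ Y) (hX2 : 2 ≤ X) :
    ∑ p ∈ P, alphaW σ X p * (p : ℝ) ^ (-(1 + 1 / Y)) ≤
      2 * max 0 (Real.log (σ * Y / X)) + 72 := by
  have hY0 : 0 < Y := by linarith
  have hX0 : 0 < X := by linarith
  have hσ0 : 0 < σ := by linarith
  have hlog2 : (0.69 : ℝ) < Real.log 2 := by linarith [Real.log_two_gt_d9]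
  have hlog2' : Real.log 2 < 0.7 := by linarith [Real.log_two_lt_d9]
  have hlog4 : Real.log 4 ≤ 1.4 := by
    rw [show (4 : ℝ) = 2 ^ 2 by norm_num, Real.log_pow]; push_cast; linarith
  have hlog4' : 0 < Real.log 4 := Real.log_pos (by norm_num)
  have hmax0 : 0 ≤ max 0 (Real.log (σ * Y / X)) := le_max_left _ _
  -- the generic tail beyond an integer `v ≥ 2` with `log v ≥ Y/2·(something)`:
  -- we use `∑_{p > v} p^{-1-1/Y} ≤ 3 log 4 · Y/log v` (dropping `v^{-1/Y} ≤ 1`)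
  have htail : ∀ v : ℕ, 2 ≤ v → ∑ p ∈ P.filter (fun p : ℕ => v < p), (p : ℝ) ^ (-(1 + 1 / Y)) ≤
      3 * Real.log 4 * Y / Real.log v := by
    intro v hv2
    have hv1 : (1 : ℝ) < v := by exact_mod_cast lt_of_lt_of_le one_lt_two hv2
    have hlogv : 0 < Real.log v := Real.log_pos hv1
    have h := sum_rpow_filter_lt_le hP (δ := 1 / Y) (by positivity)
      (by rw [div_le_one hY0]; linarith) hv2
    have hvpow : (v : ℝ) ^ (-(1 / Y)) ≤ 1 :=
      Real.rpow_le_one_of_one_le_of_nonpos hv1.le (by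
        have : 0 < 1 / Y := by positivity
        linarith)
    calc _ ≤ 3 * Real.log 4 * (v : ℝ) ^ (-(1 / Y)) / ((1 / Y) * Real.log v) := h
      _ ≤ 3 * Real.log 4 * 1 / ((1 / Y) * Real.log v) := by gcongr
      _ = 3 * Real.log 4 * Y / Real.log v := by field_simp
  -- the tail beyond `e^Y`: `v = ⌊e^Y⌋`, `log v ≥ Y - log 2 ≥ Y/2`
  have hexpY : (7 : ℝ) ≤ Real.exp Y := by
    calc (7 : ℝ) ≤ Real.exp 2 := by
          have h2 : Real.exp 2 = Real.exp 1 * Real.exp 1 := by rw [← Real.exp_add]; norm_num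
          nlinarith [Real.exp_one_gt_d9]
      _ ≤ Real.exp Y := Real.exp_le_exp.mpr hY
  have htailY : ∑ p ∈ P.filter (fun p : ℕ => Real.exp Y < (p : ℝ)), (p : ℝ) ^ (-(1 + 1 / Y)) ≤ 9 := by
    set v : ℕ := ⌊Real.exp Y⌋₊ with hv
    have hv2 : 2 ≤ v := Nat.le_floor (by push_cast; linarith)
    have hvle : (v : ℝ) ≤ Real.exp Y := Nat.floor_le (by positivity)
    have hvge : Real.exp Y / 2 ≤ v := by
      have := Nat.lt_floor_add_one (Real.exp Y); rw [← hv] at this; linarith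
    have hlogv : Y / 2 ≤ Real.log v := by
      have hl : Real.log (Real.exp Y / 2) ≤ Real.log v := Real.log_le_log (by positivity) hvge
      rw [Real.log_div (by positivity) (by norm_num), Real.log_exp] at hl
      linarith
    have hsub : P.filter (fun p : ℕ => Real.exp Y < (p : ℝ)) ⊆ P.filter (fun p : ℕ => v < p) := by
      intro p hp; rw [mem_filter] at hp ⊢
      exact ⟨hp.1, by exact_mod_cast lt_of_le_of_lt hvle hp.2⟩
    calc _ ≤ ∑ p ∈ P.filter (fun p : ℕ => v < p), (p : ℝ) ^ (-(1 + 1 / Y)) :=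
          sum_le_sum_of_subset_of_nonneg hsub fun p _ _ => by positivity
      _ ≤ 3 * Real.log 4 * Y / Real.log v := htail v hv2
      _ ≤ 3 * Real.log 4 * Y / (Y / 2) := by
          exact div_le_div_of_nonneg_left (by positivity) (by positivity) hlogv
      _ = 6 * Real.log 4 := by field_simp; ring
      _ ≤ 9 := by linarith
  -- Case analysis on the cut point
  by_cases hcase : Y < X / σ
  · -- `X/σ > Y`: cut at `w = e^{X/σ} ≥ e^Y`; no middle range
    set w : ℝ := Real.exp (X / σ) with hw
    have hwY : Real.exp Y ≤ w := Real.exp_le_exp.mpr hcase.le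
    have hsplit := sum_alphaW_rpow_le_split hP hσ0.le hX0 hY0 w
    have h1 : σ / X * ∑ p ∈ P.filter (fun p : ℕ => (p : ℝ) ≤ w), Real.log p / p ≤ 1 + 1.4 := by
      have hs := sum_log_div_filter_le hP (w := w) (by rw [hw]; exact Real.one_le_exp (by positivity))
      rw [hw, Real.log_exp] at hs
      have hσX : σ / X ≤ 1 := by
        rw [div_le_one hX0]
        by_contra h; push Not at h
        have : X / σ < 1 := by rw [div_lt_one hσ0]; exact h
        linarith
      calc σ / X * ∑ p ∈ P.filter (fun p : ℕ => (p : ℝ) ≤ w), Real.log p / p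
          ≤ σ / X * (X / σ + Real.log 4) := mul_le_mul_of_nonneg_left hs (by positivity)
        _ = 1 + σ / X * Real.log 4 := by field_simp
        _ ≤ 1 + 1 * 1.4 := by gcongr
        _ = 1 + 1.4 := by ring
    -- tail beyond `w`: `v = ⌊w⌋`, `log v ≥ X/σ - log 2 ≥ X/(2σ)`, and `Y σ/X ≤ 1`
    set v : ℕ := ⌊w⌋₊ with hv
    have hw7 : (7 : ℝ) ≤ w := hexpY.trans hwY
    have hv2 : 2 ≤ v := Nat.le_floor (by push_cast; linarith)
    have hvle : (v : ℝ) ≤ w := Nat.floor_le (by positivity)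
    have hvge : w / 2 ≤ v := by
      have := Nat.lt_floor_add_one w; rw [← hv] at this; linarith
    have hlogv : X / σ / 2 ≤ Real.log v := by
      have hl : Real.log (w / 2) ≤ Real.log v := Real.log_le_log (by positivity) hvge
      rw [Real.log_div (by positivity) (by norm_num), hw, Real.log_exp] at hl
      have : Real.log 2 ≤ X / σ / 2 := by
        have : (2 : ℝ) ≤ X / σ := hY.trans hcase.le
        linarith
      linarith
    have h2 : ∑ p ∈ P.filter (fun p : ℕ => w < (p : ℝ)), (p : ℝ) ^ (-(1 + 1 / Y)) ≤ 9 := by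
      have hsub : P.filter (fun p : ℕ => w < (p : ℝ)) ⊆ P.filter (fun p : ℕ => v < p) := by
        intro p hp; rw [mem_filter] at hp ⊢
        exact ⟨hp.1, by exact_mod_cast lt_of_le_of_lt hvle hp.2⟩
      have hXσ : 0 < X / σ := by positivity
      calc _ ≤ ∑ p ∈ P.filter (fun p : ℕ => v < p), (p : ℝ) ^ (-(1 + 1 / Y)) :=
            sum_le_sum_of_subset_of_nonneg hsub fun p _ _ => by positivity
        _ ≤ 3 * Real.log 4 * Y / Real.log v := htail v hv2
        _ ≤ 3 * Real.log 4 * Y / (X / σ / 2) :=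
            div_le_div_of_nonneg_left (by positivity) (by positivity) hlogv
        _ = 6 * Real.log 4 * (Y / (X / σ)) := by field_simp; ring
        _ ≤ 6 * Real.log 4 * 1 := by
            refine mul_le_mul_of_nonneg_left ?_ (by positivity)
            rw [div_le_one hXσ]; exact hcase.le
        _ ≤ 9 := by linarith
    calc _ ≤ _ := hsplit
      _ ≤ (1 + 1.4) + 2 * 9 := add_le_add h1 (by linarith)
      _ ≤ 2 * max 0 (Real.log (σ * Y / X)) + 72 := by linarith
  · push Not at hcase
    -- `X/σ ≤ Y`: `log(σY/X) ≥ 0`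
    have hratio : 0 ≤ Real.log (σ * Y / X) := by
      refine Real.log_nonneg ?_
      rw [le_div_iff₀ hX0, one_mul]
      calc X = X / σ * σ := by field_simp
        _ ≤ Y * σ := mul_le_mul_of_nonneg_right hcase hσ0.le
        _ = σ * Y := mul_comm _ _
    have hmax : max 0 (Real.log (σ * Y / X)) = Real.log (σ * Y / X) := max_eq_right hratio
    by_cases hsmall : X / σ < Real.log 2
    · -- cut at `w = 2`: the first range is at most the single prime `2`
      have hsplit := sum_alphaW_rpow_le_split hP hσ0.le hX0 hY0 2
      -- but we bound the first range directly by `α_p p^{-1-1/Y} ≤ 2 · 2^{-1} = 1`... we redo the split: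
      -- simpler: use the split form and bound `σ/X · ∑_{p ≤ 2} log p/p ≤ σ/X · log 2 / 2`? That can be
      -- large; instead bound the `p ≤ 2` part via `α_p ≤ 2`.
      have hfirst : ∑ p ∈ P.filter (fun p : ℕ => (p : ℝ) ≤ 2), alphaW σ X p * (p : ℝ) ^ (-(1 + 1 / Y)) ≤ 1 := by
        have hsub : P.filter (fun p : ℕ => (p : ℝ) ≤ 2) ⊆ {2} := by
          intro p hp
          rw [mem_filter] at hp
          rw [mem_singleton]
          have h2 := (hP p hp.1).two_le
          have : (p : ℝ) ≤ 2 := hp.2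
          have : p ≤ 2 := by exact_mod_cast this
          omega
        calc _ ≤ ∑ p ∈ ({2} : Finset ℕ), alphaW σ X p * (p : ℝ) ^ (-(1 + 1 / Y)) :=
              sum_le_sum_of_subset_of_nonneg hsub fun p _ _ =>
                mul_nonneg (alphaW_nonneg hσ0.le hX0 p) (by positivity)
          _ = alphaW σ X 2 * (2 : ℝ) ^ (-(1 + 1 / Y)) := by rw [sum_singleton]; norm_cast
          _ ≤ 2 * (1 / (2 : ℝ)) :=
              mul_le_mul (alphaW_le_two σ X 2) (rpow_neg_one_add_le (by norm_num) (by positivity))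
                (by positivity) (by norm_num)
          _ = 1 := by norm_num
      -- middle range `2 < p ≤ e^Y` and the tail
      have hrest : ∑ p ∈ P.filter (fun p : ℕ => ¬ (p : ℝ) ≤ 2), alphaW σ X p * (p : ℝ) ^ (-(1 + 1 / Y)) ≤
          2 * (Real.log (Real.log (Real.exp Y)) - Real.log (Real.log 2) + 24) + 2 * 9 := by
        have hsplit2 := (sum_filter_add_sum_filter_not (P.filter (fun p : ℕ => ¬ (p : ℝ) ≤ 2))
          (fun p : ℕ => (p : ℝ) ≤ Real.exp Y) (fun p => alphaW σ X p * (p : ℝ) ^ (-(1 + 1 / Y)))).symm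
        rw [hsplit2, filter_filter, filter_filter]
        refine add_le_add ?_ ?_
        · have hmid := sum_inv_filter_Ioc_le hP (w := 2) (w' := Real.exp Y) le_rfl (by linarith)
          have hset : P.filter (fun p : ℕ => ¬ (p : ℝ) ≤ 2 ∧ (p : ℝ) ≤ Real.exp Y) =
              P.filter (fun p : ℕ => 2 < (p : ℝ) ∧ (p : ℝ) ≤ Real.exp Y) := by
            refine filter_congr fun p _ => ?_; rw [not_le]
          rw [hset]
          calc _ ≤ ∑ p ∈ P.filter (fun p : ℕ => 2 < (p : ℝ) ∧ (p : ℝ) ≤ Real.exp Y), 2 * ((1 : ℝ) / p) := by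
                refine sum_le_sum fun p hp => ?_
                rw [mem_filter] at hp
                have hp1 : (1 : ℝ) ≤ p := by exact_mod_cast (hP p hp.1).one_le
                have h1 : (p : ℝ) ^ (-(1 + 1 / Y)) ≤ 1 / p := rpow_neg_one_add_le hp1 (by positivity)
                exact mul_le_mul (alphaW_le_two σ X p) h1 (by positivity) (by norm_num)
            _ = 2 * ∑ p ∈ P.filter (fun p : ℕ => 2 < (p : ℝ) ∧ (p : ℝ) ≤ Real.exp Y), (1 : ℝ) / p := by
                rw [mul_sum]
            _ ≤ _ := by linarith
        · have hset : P.filter (fun p : ℕ => ¬ (p : ℝ) ≤ 2 ∧ ¬ (p : ℝ) ≤ Real.exp Y) ⊆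
              P.filter (fun p : ℕ => Real.exp Y < (p : ℝ)) := by
            intro p hp; rw [mem_filter] at hp ⊢; exact ⟨hp.1, not_le.mp hp.2.2⟩
          calc _ ≤ ∑ p ∈ P.filter (fun p : ℕ => Real.exp Y < (p : ℝ)), alphaW σ X p * (p : ℝ) ^ (-(1 + 1 / Y)) :=
                sum_le_sum_of_subset_of_nonneg hset fun p _ _ =>
                  mul_nonneg (alphaW_nonneg hσ0.le hX0 p) (by positivity)
            _ ≤ ∑ p ∈ P.filter (fun p : ℕ => Real.exp Y < (p : ℝ)), 2 * (p : ℝ) ^ (-(1 + 1 / Y)) :=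
                sum_le_sum fun p _ => mul_le_mul_of_nonneg_right (alphaW_le_two σ X p) (by positivity)
            _ = 2 * ∑ p ∈ P.filter (fun p : ℕ => Real.exp Y < (p : ℝ)), (p : ℝ) ^ (-(1 + 1 / Y)) := by
                rw [mul_sum]
            _ ≤ 2 * 9 := by linarith [htailY]
      rw [Real.log_exp] at hrest
      have hll2 : -0.7 ≤ Real.log (Real.log 2) := by
        have : Real.log (1 / 2) ≤ Real.log (Real.log 2) := Real.log_le_log (by norm_num) (by linarith)
        have h12 : Real.log (1 / 2) = -Real.log 2 := by rw [one_div, Real.log_inv]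
        linarith
      -- `log Y ≤ log(σY/X) + log(log 2)`: since `X/σ < log 2`, `Y/log 2 ≤ σY/X`
      have hlogY : Real.log Y ≤ Real.log (σ * Y / X) + Real.log (Real.log 2) := by
        have h1 : Y / Real.log 2 ≤ σ * Y / X := by
          rw [div_le_div_iff₀ (by linarith) hX0]
          have : X < σ * Real.log 2 := by rwa [div_lt_iff₀ hσ0, mul_comm] at hsmall
          nlinarith
        have h2 := Real.log_le_log (by positivity) h1
        rw [Real.log_div (by linarith) (by linarith)] at h2
        linarith
      have htot := (sum_filter_add_sum_filter_not P (fun p : ℕ => (p : ℝ) ≤ 2)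
        (fun p => alphaW σ X p * (p : ℝ) ^ (-(1 + 1 / Y)))).symm
      rw [htot, hmax]
      linarith
    · push Not at hsmall
      -- cut at `w = e^{X/σ}`, `2 ≤ w ≤ e^Y`
      set w : ℝ := Real.exp (X / σ) with hw
      have hw2 : (2 : ℝ) ≤ w := by
        rw [hw]
        calc (2 : ℝ) = Real.exp (Real.log 2) := (Real.exp_log (by norm_num)).symm
          _ ≤ Real.exp (X / σ) := Real.exp_le_exp.mpr hsmall
      have hwY : w ≤ Real.exp Y := Real.exp_le_exp.mpr hcase
      have hsplit := sum_alphaW_rpow_le_split hP hσ0.le hX0 hY0 w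
      have h1 : σ / X * ∑ p ∈ P.filter (fun p : ℕ => (p : ℝ) ≤ w), Real.log p / p ≤ 1 + σ / X * Real.log 4 := by
        have hs := sum_log_div_filter_le hP (w := w) (by linarith)
        rw [hw, Real.log_exp] at hs
        calc σ / X * ∑ p ∈ P.filter (fun p : ℕ => (p : ℝ) ≤ w), Real.log p / p
            ≤ σ / X * (X / σ + Real.log 4) := mul_le_mul_of_nonneg_left hs (by positivity)
          _ = 1 + σ / X * Real.log 4 := by field_simp
      -- `σ/X ≤ 1/log 2`
      have hσX : σ / X * Real.log 4 ≤ 2.1 := by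
        have h1 : σ / X ≤ 1 / Real.log 2 := by
          rw [div_le_div_iff₀ hX0 (by linarith), one_mul]
          calc σ * Real.log 2 ≤ σ * (X / σ) := mul_le_mul_of_nonneg_left hsmall hσ0.le
            _ = X := by field_simp
        calc σ / X * Real.log 4 ≤ 1 / Real.log 2 * 1.4 :=
              mul_le_mul h1 hlog4 hlog4'.le (by positivity)
          _ ≤ 2.1 := by rw [div_mul_eq_mul_div, div_le_iff₀ (by linarith)]; nlinarith
      -- the part `p > w`: middle range up to `e^Y`, then the tail
      have h2 : ∑ p ∈ P.filter (fun p : ℕ => w < (p : ℝ)), (p : ℝ) ^ (-(1 + 1 / Y)) ≤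
          (Real.log Y - Real.log (X / σ) + 24) + 9 := by
        have hsplit2 := (sum_filter_add_sum_filter_not (P.filter (fun p : ℕ => w < (p : ℝ)))
          (fun p : ℕ => (p : ℝ) ≤ Real.exp Y) (fun p : ℕ => (p : ℝ) ^ (-(1 + 1 / Y)))).symm
        rw [hsplit2, filter_filter, filter_filter]
        refine add_le_add ?_ ?_
        · have hmid := sum_inv_filter_Ioc_le hP hw2 hwY
          rw [Real.log_exp, hw, Real.log_exp] at hmid
          calc _ ≤ ∑ p ∈ P.filter (fun p : ℕ => w < (p : ℝ) ∧ (p : ℝ) ≤ Real.exp Y), (1 : ℝ) / p := by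
                refine sum_le_sum fun p hp => ?_
                rw [mem_filter] at hp
                have hp1 : (1 : ℝ) ≤ p := by exact_mod_cast (hP p hp.1).one_le
                exact rpow_neg_one_add_le hp1 (by positivity)
            _ ≤ _ := hmid
        · have hset : P.filter (fun p : ℕ => w < (p : ℝ) ∧ ¬ (p : ℝ) ≤ Real.exp Y) ⊆
              P.filter (fun p : ℕ => Real.exp Y < (p : ℝ)) := by
            intro p hp; rw [mem_filter] at hp ⊢; exact ⟨hp.1, not_le.mp hp.2.2⟩
          exact le_trans (sum_le_sum_of_subset_of_nonneg hset fun p _ _ => by positivity) htailY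
      have hlogratio : Real.log Y - Real.log (X / σ) = Real.log (σ * Y / X) := by
        rw [← Real.log_div (by linarith) (by positivity)]
        congr 1; field_simp
      rw [hlogratio] at h2
      rw [hmax]
      calc _ ≤ _ := hsplit
        _ ≤ (1 + σ / X * Real.log 4) + 2 * ((Real.log (σ * Y / X) + 24) + 9) := add_le_add h1 (by linarith)
        _ ≤ 2 * Real.log (σ * Y / X) + 72 := by linarith

end Sums

/-! ### The size of `∏_{p ≥ C₀} (1 - p^{-1-z})` -/

/-- `1 - y(1 - α) ≤ exp(-y(1 - α))`. [folklore] -/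
theorem one_sub_mul_le_exp (y α : ℝ) : 1 - y * (1 - α) ≤ Real.exp (-(y * (1 - α))) := by
  have := Real.add_one_le_exp (-(y * (1 - α)))
  linarith

/-- **One factor**: for `p ≥ 2`, `Re z = 1/X`, `‖z‖ ≤ σ/X` (`X > 0`),
`‖1 - p^{-(1+z)}‖ ≤ (1 - p^{-1-1/X}) + p^{-1-1/X} α_p ≤ exp(-p^{-1-1/X}(1 - α_p))`.
[cite: TaoTeravainen2021, §3.1 (3.2)] -/
theorem norm_one_sub_cpow_factor_le {p : ℕ} (hp : 2 ≤ p) {X σ : ℝ} (hX : 0 < X) {z : ℂ}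
    (hzre : z.re = 1 / X) (hzσ : ‖z‖ ≤ σ / X) :
    ‖1 - (p : ℂ) ^ (-(1 + z))‖ ≤
      Real.exp (-((p : ℝ) ^ (-(1 + 1 / X)) * (1 - alphaW σ X p))) := by
  have hp0 : p ≠ 0 := by omega
  have hp0' : (p : ℂ) ≠ 0 := Nat.cast_ne_zero.mpr hp0
  have hpR : (0 : ℝ) < p := by exact_mod_cast Nat.pos_of_ne_zero hp0
  -- split `1 + z = (1 + 1/X) + i Im z`
  set y : ℝ := (p : ℝ) ^ (-(1 + 1 / X)) with hy
  set τ : ℂ := (z.im : ℂ) * Complex.I with hτ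
  have hz : z = ((1 / X : ℝ) : ℂ) + τ := by
    apply Complex.ext <;> simp [hτ, hzre]
  have hsplit : (p : ℂ) ^ (-(1 + z)) = (y : ℂ) * (p : ℂ) ^ (-τ) := by
    rw [hz, show -(1 + (((1 / X : ℝ) : ℂ) + τ)) = (-(((1 + 1 / X : ℝ)) : ℂ)) + -τ by push_cast; ring,
      Complex.cpow_add _ _ hp0', hy, ← Complex.ofReal_natCast, ← Complex.ofReal_neg,
      ← Complex.ofReal_cpow (Nat.cast_nonneg p)]
  have hτre : 0 ≤ τ.re := by simp [hτ]
  have hτnorm : ‖τ‖ ≤ σ / X := by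
    calc ‖τ‖ = |z.im| := by simp [hτ]
      _ ≤ ‖z‖ := Complex.abs_im_le_norm z
      _ ≤ σ / X := hzσ
  have hα : ‖1 - (p : ℂ) ^ (-τ)‖ ≤ alphaW σ X p :=
    norm_one_sub_natCast_cpow_neg_le_alphaW hp0 hτre hτnorm
  have hy0 : 0 ≤ y := by positivity
  have hp1R : (1 : ℝ) ≤ p := by exact_mod_cast (show 1 ≤ p by omega)
  have hnonpos : -(1 + 1 / X) ≤ (0 : ℝ) := by
    have : (0 : ℝ) < 1 / X := by positivity
    linarith
  have hy1 : y ≤ 1 := Real.rpow_le_one_of_one_le_of_nonpos hp1R hnonpos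
  calc ‖1 - (p : ℂ) ^ (-(1 + z))‖ = ‖(1 - (y : ℂ)) + (y : ℂ) * (1 - (p : ℂ) ^ (-τ))‖ := by
        rw [hsplit]; ring_nf
    _ ≤ ‖(1 : ℂ) - y‖ + ‖(y : ℂ) * (1 - (p : ℂ) ^ (-τ))‖ := norm_add_le _ _
    _ = (1 - y) + y * ‖1 - (p : ℂ) ^ (-τ)‖ := by
        rw [norm_mul, Complex.norm_real, Real.norm_eq_abs, abs_of_nonneg hy0, ← Complex.ofReal_one,
          ← Complex.ofReal_sub, Complex.norm_real, Real.norm_eq_abs, abs_of_nonneg (by linarith)]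
    _ ≤ (1 - y) + y * alphaW σ X p := by gcongr
    _ = 1 - y * (1 - alphaW σ X p) := by ring
    _ ≤ Real.exp (-(y * (1 - alphaW σ X p))) := one_sub_mul_le_exp y _

/-- `p^{-1-1/X} ≥ (1 - log p/X)/p` (`p ≥ 1`). [folklore] -/
theorem rpow_neg_one_sub_ge {p : ℕ} (hp : 1 ≤ p) (X : ℝ) :
    (1 - Real.log p / X) / p ≤ (p : ℝ) ^ (-(1 + 1 / X)) := by
  have hpR : (0 : ℝ) < p := by exact_mod_cast hp
  have h1 : (p : ℝ) ^ (-(1 + 1 / X)) = (p : ℝ)⁻¹ * Real.exp (-(Real.log p / X)) := by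
    rw [show -(1 + 1 / X) = (-1 : ℝ) + -(1 / X) by ring, Real.rpow_add hpR, Real.rpow_neg_one,
      Real.rpow_def_of_pos hpR]
    congr 1; congr 1; ring
  rw [h1, div_eq_inv_mul]
  refine mul_le_mul_of_nonneg_left ?_ (by positivity)
  have := Real.add_one_le_exp (-(Real.log p / X))
  linarith

/-- **The size of the main-term Euler factor** (the elementary upper bound replacing
`|∏_p (1 - p^{-s})| = |1/ζ(s)| ≍ |s - 1|`, (3.2)): for `C₀ ≥ 2`, `X ≥ 2`, `σ ≥ 1`, `Re z = 1/X`,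
`‖z‖ ≤ σ/X`, and a finite set of primes `P` containing every prime of `[C₀, e^X]`,
`‖∏_{p ∈ P, p ≥ C₀} (1 - p^{-(1+z)})‖ ≤ exp(log log C₀ + 6/log C₀ + 77) · σ²/X`.
[cite: TaoTeravainen2021, §3.1 (3.2) and §8 (8.25)] -/
theorem norm_prod_one_sub_cpow_le {P : Finset ℕ} (hP : ∀ p ∈ P, p.Prime) {C₀ : ℕ} (hC₀ : 2 ≤ C₀)
    {X σ : ℝ} (hX : 2 ≤ X) (hσ : 1 ≤ σ) (hC₀X : (C₀ : ℝ) ≤ Real.exp X)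
    (hPsup : ∀ p : ℕ, p.Prime → C₀ ≤ p → (p : ℝ) ≤ Real.exp X → p ∈ P)
    {z : ℂ} (hzre : z.re = 1 / X) (hzσ : ‖z‖ ≤ σ / X) :
    ‖∏ p ∈ P.filter (fun p : ℕ => C₀ ≤ p), (1 - (p : ℂ) ^ (-(1 + z)))‖ ≤
      Real.exp (Real.log (Real.log C₀) + 6 / Real.log C₀ + 77) * σ ^ 2 / X := by
  have hX0 : 0 < X := by linarith
  have hσ0 : 0 < σ := by linarith
  have hC₀R : (2 : ℝ) ≤ C₀ := by exact_mod_cast hC₀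
  set Q := P.filter (fun p : ℕ => C₀ ≤ p) with hQ
  have hQP : ∀ p ∈ Q, p.Prime := fun p hp => hP p (mem_filter.mp hp).1
  -- factorwise
  have hfac : ∀ p ∈ Q, ‖1 - (p : ℂ) ^ (-(1 + z))‖ ≤
      Real.exp (-((p : ℝ) ^ (-(1 + 1 / X)) * (1 - alphaW σ X p))) :=
    fun p hp => norm_one_sub_cpow_factor_le (hQP p hp).two_le hX0 hzre hzσ
  have hprod : ‖∏ p ∈ Q, (1 - (p : ℂ) ^ (-(1 + z)))‖ ≤
      Real.exp (∑ p ∈ Q, -((p : ℝ) ^ (-(1 + 1 / X)) * (1 - alphaW σ X p))) := by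
    rw [norm_prod, Real.exp_sum]
    exact prod_le_prod (fun p _ => norm_nonneg _) hfac
  -- the exponent: `-∑ y_p + ∑ y_p α_p`
  have hexp : ∑ p ∈ Q, -((p : ℝ) ^ (-(1 + 1 / X)) * (1 - alphaW σ X p)) =
      -(∑ p ∈ Q, (p : ℝ) ^ (-(1 + 1 / X))) + ∑ p ∈ Q, alphaW σ X p * (p : ℝ) ^ (-(1 + 1 / X)) := by
    rw [← sum_neg_distrib, ← sum_add_distrib]
    refine sum_congr rfl fun p _ => ?_; ring
  -- upper bound for `∑ y_p α_p` (crude regime with `Y = X`)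
  have hup : ∑ p ∈ Q, alphaW σ X p * (p : ℝ) ^ (-(1 + 1 / X)) ≤ 2 * Real.log σ + 72 := by
    have h := sum_alphaW_rpow_le_crude hQP hσ hX hX
    have hmax : max 0 (Real.log (σ * X / X)) = Real.log σ := by
      rw [mul_div_assoc, div_self hX0.ne', mul_one, max_eq_right (Real.log_nonneg hσ)]
    rwa [hmax] at h
  -- lower bound for `∑ y_p`: the primes of `[C₀, e^X]`
  have hlow : Real.log X - Real.log (Real.log C₀) - 6 / Real.log C₀ - 2 ≤
      ∑ p ∈ Q, (p : ℝ) ^ (-(1 + 1 / X)) := by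
    set I := (Icc ⌈(C₀ : ℝ)⌉₊ ⌊Real.exp X⌋₊).filter Nat.Prime with hI
    have hIQ : I ⊆ Q := by
      intro p hp
      rw [hI, mem_filter, mem_Icc, Nat.ceil_natCast] at hp
      rw [hQ, mem_filter]
      refine ⟨hPsup p hp.2 hp.1.1 ?_, hp.1.1⟩
      exact le_trans (by exact_mod_cast hp.1.2) (Nat.floor_le (by positivity))
    have hmert := loglog_sub_loglog_le_sum_inv_prime_Icc hC₀R hC₀X
    rw [Real.log_exp] at hmert
    have hlogsum : ∑ p ∈ I, Real.log p / p ≤ X + Real.log 4 := by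
      have hsub : I ⊆ Nat.primesLE ⌊Real.exp X⌋₊ := by
        intro p hp
        rw [hI, mem_filter, mem_Icc] at hp
        exact Nat.mem_primesLE.mpr ⟨hp.1.2, hp.2⟩
      calc ∑ p ∈ I, Real.log p / p ≤ ∑ p ∈ Nat.primesLE ⌊Real.exp X⌋₊, Real.log p / p :=
            sum_le_sum_of_subset_of_nonneg hsub fun p _ _ =>
              div_nonneg (Real.log_natCast_nonneg p) (Nat.cast_nonneg p)
        _ ≤ Real.log ⌊Real.exp X⌋₊ + Real.log 4 := sum_log_div_prime_le _
        _ ≤ X + Real.log 4 := by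
            gcongr
            calc Real.log ⌊Real.exp X⌋₊ ≤ Real.log (Real.exp X) := by
                  refine Real.log_le_log ?_ (Nat.floor_le (by positivity))
                  have : (2 : ℝ) ≤ ⌊Real.exp X⌋₊ := by
                    exact_mod_cast Nat.le_floor (by push_cast; linarith)
                  linarith
              _ = X := Real.log_exp X
    have hterm : ∀ p ∈ I, (1 : ℝ) / p - (1 / X) * (Real.log p / p) ≤ (p : ℝ) ^ (-(1 + 1 / X)) := by
      intro p hp
      have hp1 := ((mem_filter.mp hp).2).one_le
      have := rpow_neg_one_sub_ge hp1 X
      calc (1 : ℝ) / p - (1 / X) * (Real.log p / p) = (1 - Real.log p / X) / p := by ring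
        _ ≤ _ := this
    have hlog4 : Real.log 4 ≤ 2 := by
      rw [show (4 : ℝ) = 2 ^ 2 by norm_num, Real.log_pow]; push_cast
      linarith [Real.log_two_lt_d9]
    calc Real.log X - Real.log (Real.log C₀) - 6 / Real.log C₀ - 2
        ≤ (∑ p ∈ I, (1 : ℝ) / p) - (1 / X) * ∑ p ∈ I, Real.log p / p := by
          have h2 : (1 / X) * ∑ p ∈ I, Real.log p / p ≤ (1 / X) * (X + Real.log 4) :=
            mul_le_mul_of_nonneg_left hlogsum (by positivity)
          have h3 : (1 / X) * (X + Real.log 4) = 1 + Real.log 4 / X := by field_simp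
          have h4 : Real.log 4 / X ≤ 1 := by rw [div_le_one hX0]; linarith
          linarith
      _ = ∑ p ∈ I, ((1 : ℝ) / p - (1 / X) * (Real.log p / p)) := by rw [sum_sub_distrib, mul_sum]
      _ ≤ ∑ p ∈ I, (p : ℝ) ^ (-(1 + 1 / X)) := sum_le_sum hterm
      _ ≤ ∑ p ∈ Q, (p : ℝ) ^ (-(1 + 1 / X)) :=
          sum_le_sum_of_subset_of_nonneg hIQ fun p _ _ => by positivity
  -- assemble
  have hlogσ : Real.exp (2 * Real.log σ) = σ ^ 2 := by
    rw [show 2 * Real.log σ = Real.log σ + Real.log σ by ring, Real.exp_add, Real.exp_log hσ0, sq]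
  calc ‖∏ p ∈ Q, (1 - (p : ℂ) ^ (-(1 + z)))‖
      ≤ Real.exp (∑ p ∈ Q, -((p : ℝ) ^ (-(1 + 1 / X)) * (1 - alphaW σ X p))) := hprod
    _ ≤ Real.exp (-(Real.log X - Real.log (Real.log C₀) - 6 / Real.log C₀ - 2) +
          (2 * Real.log σ + 72)) := by
        rw [hexp]; exact Real.exp_le_exp.mpr (by linarith)
    _ = Real.exp (Real.log (Real.log C₀) + 6 / Real.log C₀ + 74) * σ ^ 2 / X := by
        rw [show -(Real.log X - Real.log (Real.log C₀) - 6 / Real.log C₀ - 2) + (2 * Real.log σ + 72) =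
          (Real.log (Real.log C₀) + 6 / Real.log C₀ + 74) + 2 * Real.log σ + -Real.log X by ring,
          Real.exp_add, Real.exp_add, hlogσ, Real.exp_neg, Real.exp_log hX0]
        ring
    _ ≤ Real.exp (Real.log (Real.log C₀) + 6 / Real.log C₀ + 77) * σ ^ 2 / X := by
        gcongr
        norm_num

end MainTerm

end TaoTeravainen

end Literature.Barriers.Parity
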